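import Mathlib
import HarnessLib
import Summits.HubbardSuperconductivity.HubbardSuperconductivity.Theses.KLProgramme
import Summits.HubbardSuperconductivity.HubbardSuperconductivity.Theorems.KLProgrammeKLRegimeRenormFlowV17F2

/-!
# Route `KLProgramme` — crux K3 gen-8 (7-flow, cure 1), child 2-F `KLRegimeRenormFlowV17F2 := CountertermP2 klPredsV17F2 klWindowC`, CLOSED by the forward induction
# `KLRegimeSplit.countertermP2_klPredsV17F2_holds` (`…RenormFlowV17F2`; seat hubbard-kl-k3c3-p2, jets step from k3c3-p3's p524080).  Proof only; nothing
# here asserts superconductivity.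
-/

noncomputable section

namespace Summit.HubbardSuperconductivity.HubbardSuperconductivity.Theorems.KLRegimeCounterterm

set_option linter.dupNamespace false -- summit = problem name (single-conjunct summit), D-0017

/-- **Gen-8 (7-flow, cure 1) child RenormFlow of crux K3, CLOSED**: the route decl `…Theses.KLProgramme.KLRegimeRenormFlowV17F2` by name, from the body
`KLRegimeSplit.countertermP2_klPredsV17F2_holds`. -/
theorem KLRegimeRenormFlowV17F2_of :
    Summit.HubbardSuperconductivity.HubbardSuperconductivity.Theses.KLProgramme.KLRegimeRenormFlowV17F2 :=
  KLRegimeSplit.countertermP2_klPredsV17F2_holds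

end Summit.HubbardSuperconductivity.HubbardSuperconductivity.Theorems.KLRegimeCounterterm

end
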